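import Mathlib.RepresentationTheory.Irreducible
import Mathlib.RepresentationTheory.Semisimple
import Mathlib.LinearAlgebra.Eigenspace.Triangularizable
import Literature.RepresentationTheory.Semisimple.CliffordRestriction
import Literature.RepresentationTheory.Semisimple.Multiplicity
import Summits.Langlands.Langlands.Theorems.IrreducibilityBySelfDualityIrreducibleOffSectorSemiInvariantCharacter
import Summits.Langlands.Langlands.Theorems.IrreducibilityBySelfDualityIrreducibleOffSectorEigenvectorOfFiniteOrder
import Summits.Langlands.Langlands.Theorems.IrreducibilityBySelfDualityIrreducibleOffSectorNonscalarIntertwiner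
import HarnessLib

/-!
# Clifford's dichotomy for a normal subgroup with finite cyclic quotient
(crux stmt-Langlands-14329 `IrreducibilityBySelfDuality.IrreducibleOffSector`, line `Sketch`;
`--supports` file, STRUCTURAL: pure representation theory, no import of the route module;
continuation lead c7)

The crux says that every `ρ : Γ_K → GL_n(ℚ̄_ℓ)` Satake–Frobenius compatible with a cuspidal
L-algebraic `π` is irreducible.  Lead c4 proved that this conclusion DESCENDS along weak base change
(`…IrreducibleOffSectorBaseChange`); this lead adds the ASCENT along cyclic base change, whose
Galois-theoretic core is the following theorem of Clifford theory, absent from the tree so far (the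
tree has only the dimension-parity case for index two,
`Literature.NumberTheory.GaloisRepresentations.Representation.isIrreducible_comp_of_index_two`).

**Theorem** (`clifford_cyclic`).  Let `k` be an algebraically closed field, `π` an irreducible
representation of a group `G` on a finite-dimensional `k`-space `V`, `N ◁ G` a normal subgroup
with `G/N` cyclic, generated by the class of `g₀`, of order dividing `m` with `m ≠ 0` in `k`
(`g₀ ^ m ∈ N`, every `g` is `g₀ ^ i * h` with `h ∈ N`).  Then either `π|_N` is irreducible, or
`π ≅ π ⊗ χ` for a character `χ : G → kˣ` trivial on `N`, non-trivial, with `χ ^ m = 1`.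

Proof (Clifford 1937; Curtis–Reiner §§49–51).  `π|_N` is semisimple (Clifford's theorem,
`Literature.RepresentationTheory.Semisimple.Representation.isSemisimpleRepresentation_restrictSubgroup`).
If it is reducible, the projection onto a proper complemented `N`-subrepresentation is a non-scalar
element of `E = End_N(π)` (`exists_nonscalar_intertwiningMap_of_not_isIrreducible`, p127429).
Conjugation by `π(g₀)` is a `k`-linear operator `A` on the finite-dimensional space `E`
(`conjIntertwinerLinear`; `N` normal) with `A ^ m = 1` (`g₀ ^ m ∈ N` acts trivially) and `A ≠ 1`:
an `A`-fixed `N`-intertwiner commutes with `π(g₀)` and `π(N)`, hence with `π(G)`, hence is scalar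
by Schur (Mathlib `Representation.IsIrreducible.algebraMap_intertwiningMap_bijective_of_isAlgClosed`).
So `A` has an eigenvector `T ≠ 0` with eigenvalue `λ ≠ 1` (`exists_eigenvector_ne_one_of_pow_eq_one`,
p127421): `π(g₀) T = λ T π(g₀)`, `π(h) T = T π(h)` for `h ∈ N`, whence `π(g) T = c_g T π(g)` for
all `g`, and the scalars `c_g` form a character `χ` (`exists_character_of_semiInvariant`, p127366)
with `χ|_N = 1`, `χ(g₀) = λ ≠ 1`, `χ ^ m = 1`; `T` is then a non-zero `G`-map `π → π ⊗ χ⁻¹`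
between irreducibles, i.e. an isomorphism.

References: A. H. Clifford, *Representations induced in an invariant subgroup*, Ann. of Math. 38
(1937), Thms. 1–3; C. W. Curtis, I. Reiner, *Representation Theory of Finite Groups and
Associative Algebras* (1962), (49.2), (49.7), (51.7).
-/

noncomputable section

-- `Summit.Langlands.Langlands.…` (summit = sub-problem name, D-0017 layout) trips `dupNamespace`.
set_option linter.dupNamespace false

open Literature.RepresentationTheory.Semisimple

namespace Summit.Langlands.Langlands.Theorems.IrreducibleOffSector

/-! ## Conjugation of `N`-intertwiners by elements of `G` -/

section Conj

variable {k : Type*} [Field k] {G : Type*} [Group G] {V : Type*} [AddCommGroup V] [Module k V]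
  (π : Representation k G V) (N : Subgroup G) [hN : N.Normal]

omit hN in
/-- An `N`-intertwiner commutes with `π n`, `n ∈ N` (pointwise form). [folklore] -/
theorem intertwiningMap_apply_comm (T : (Representation.restrictSubgroup π N).IntertwiningMap (Representation.restrictSubgroup π N))
    {n : G} (hn : n ∈ N) (v : V) : T.toLinearMap (π n v) = π n (T.toLinearMap v) := by
  have h := T.isIntertwining' ⟨n, hn⟩
  exact congrArg (fun f : V →ₗ[k] V => f v) h

/-- **Conjugation** of an `N`-intertwiner `T` of `π|_N` by `g ∈ G`: `π(g) ∘ T ∘ π(g)⁻¹` is again an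
`N`-intertwiner, because `N` is normal. [folklore] -/
def conjIntertwiner (g : G) (T : (Representation.restrictSubgroup π N).IntertwiningMap (Representation.restrictSubgroup π N)) :
    (Representation.restrictSubgroup π N).IntertwiningMap (Representation.restrictSubgroup π N) where
  toLinearMap := π g ∘ₗ T.toLinearMap ∘ₗ π g⁻¹
  isIntertwining' n := by
    refine LinearMap.ext fun v => ?_
    have hn' : g⁻¹ * (n : G) * g ∈ N := by
      simpa using hN.conj_mem (n : G) n.2 g⁻¹
    simp only [LinearMap.comp_apply, MonoidHom.coe_comp, Function.comp_apply,
      Subgroup.coe_subtype]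
    -- `π g⁻¹ (π n v) = π (g⁻¹ n g) (π g⁻¹ v)`
    have e1 : π g⁻¹ (π (n : G) v) = π (g⁻¹ * (n : G) * g) (π g⁻¹ v) := by
      rw [← Module.End.mul_apply, ← map_mul, ← Module.End.mul_apply, ← map_mul]
      congr 2
      group
    -- `π n (π g w) = π g (π (g⁻¹ n g) w)`
    have e2 : ∀ w, π (n : G) (π g w) = π g (π (g⁻¹ * (n : G) * g) w) := fun w => by
      rw [← Module.End.mul_apply, ← map_mul, ← Module.End.mul_apply, ← map_mul]
      congr 2
      group
    rw [e1, intertwiningMap_apply_comm π N T hn', e2]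

/-- Unfolding lemma for `conjIntertwiner`. [folklore] -/
@[simp] theorem toLinearMap_conjIntertwiner (g : G)
    (T : (Representation.restrictSubgroup π N).IntertwiningMap (Representation.restrictSubgroup π N)) :
    (conjIntertwiner π N g T).toLinearMap = π g ∘ₗ T.toLinearMap ∘ₗ π g⁻¹ := rfl

/-- Conjugation is multiplicative in `g`. [folklore] -/
theorem conjIntertwiner_mul (g g' : G)
    (T : (Representation.restrictSubgroup π N).IntertwiningMap (Representation.restrictSubgroup π N)) :
    conjIntertwiner π N (g * g') T = conjIntertwiner π N g (conjIntertwiner π N g' T) := by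
  refine Representation.IntertwiningMap.ext ?_
  simp only [toLinearMap_conjIntertwiner, map_mul, mul_inv_rev, Module.End.mul_eq_comp,
    LinearMap.comp_assoc]

/-- Conjugation by an element of `N` is the identity on `N`-intertwiners. [folklore] -/
theorem conjIntertwiner_of_mem {n : G} (hn : n ∈ N)
    (T : (Representation.restrictSubgroup π N).IntertwiningMap (Representation.restrictSubgroup π N)) :
    conjIntertwiner π N n T = T := by
  refine Representation.IntertwiningMap.ext (LinearMap.ext fun v => ?_)
  simp only [toLinearMap_conjIntertwiner, LinearMap.comp_apply]
  rw [← intertwiningMap_apply_comm π N T hn, ← Module.End.mul_apply (π n) (π n⁻¹) v, ← map_mul,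
    mul_inv_cancel, map_one, Module.End.one_apply]

/-- Conjugation by `g` as a `k`-linear operator on the space of `N`-intertwiners. [folklore] -/
def conjIntertwinerLinear (g : G) :
    (Representation.restrictSubgroup π N).IntertwiningMap (Representation.restrictSubgroup π N) →ₗ[k]
      (Representation.restrictSubgroup π N).IntertwiningMap (Representation.restrictSubgroup π N) where
  toFun := conjIntertwiner π N g
  map_add' S T := Representation.IntertwiningMap.ext (by
    simp only [toLinearMap_conjIntertwiner, Representation.IntertwiningMap.add_toLinearMap,
      LinearMap.comp_add, LinearMap.add_comp])
  map_smul' c T := Representation.IntertwiningMap.ext (by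
    simp only [toLinearMap_conjIntertwiner, Representation.IntertwiningMap.toLinearMap_smul,
      LinearMap.comp_smul, LinearMap.smul_comp, RingHom.id_apply])

/-- Unfolding lemma for `conjIntertwinerLinear`. [folklore] -/
@[simp] theorem conjIntertwinerLinear_apply (g : G)
    (T : (Representation.restrictSubgroup π N).IntertwiningMap (Representation.restrictSubgroup π N)) :
    conjIntertwinerLinear π N g T = conjIntertwiner π N g T := rfl

/-- Powers of the conjugation operator: `A_g^j = A_{g^j}`. [folklore] -/
theorem conjIntertwinerLinear_pow_apply (g : G) (j : ℕ)
    (T : (Representation.restrictSubgroup π N).IntertwiningMap (Representation.restrictSubgroup π N)) :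
    (conjIntertwinerLinear π N g ^ j) T = conjIntertwiner π N (g ^ j) T := by
  induction j generalizing T with
  | zero =>
    simp only [pow_zero, Module.End.one_apply]
    exact (conjIntertwiner_of_mem π N N.one_mem T).symm
  | succ j ih =>
    rw [pow_succ, Module.End.mul_apply, ih, pow_succ, conjIntertwiner_mul, conjIntertwinerLinear_apply]

end Conj

/-! ## Clifford's dichotomy -/

section SemiInvariant

variable {k : Type*} [Field k] {G : Type*} [Group G] {V : Type*} [AddCommGroup V] [Module k V]

/-- Semi-invariance propagates to powers: if `π(g) ∘ T = c • T ∘ π(g)` then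
`π(g^i) ∘ T = c^i • T ∘ π(g^i)`. [folklore] -/
theorem comp_pow_eq_smul_of_comp_eq_smul (π : Representation k G V) (T : V →ₗ[k] V) {g : G}
    {c : k} (h : π g ∘ₗ T = c • (T ∘ₗ π g)) (i : ℕ) :
    π (g ^ i) ∘ₗ T = c ^ i • (T ∘ₗ π (g ^ i)) := by
  induction i with
  | zero => simp only [pow_zero, map_one, one_smul]; rfl
  | succ i ih =>
    rw [pow_succ', map_mul, Module.End.mul_eq_comp, LinearMap.comp_assoc, ih,
      LinearMap.comp_smul, ← LinearMap.comp_assoc, h, LinearMap.smul_comp, smul_smul,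
      LinearMap.comp_assoc, ← pow_succ]

/-- An `N`-intertwiner fixed by conjugation by `g₀` commutes with `π(g)` for every
`g = g₀^i h`, `h ∈ N`. [folklore] -/
theorem comp_eq_comp_of_conj_fixed (π : Representation k G V) (N : Subgroup G) [N.Normal]
    (T : (Representation.restrictSubgroup π N).IntertwiningMap (Representation.restrictSubgroup π N)) {g₀ : G}
    (hfix : conjIntertwiner π N g₀ T = T)
    (hgen : ∀ g : G, ∃ (i : ℕ) (h : G), h ∈ N ∧ g = g₀ ^ i * h) (g : G) :
    π g ∘ₗ T.toLinearMap = T.toLinearMap ∘ₗ π g := by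
  -- `π g₀ ∘ T = T ∘ π g₀`
  have h0 : π g₀ ∘ₗ T.toLinearMap = (1 : k) • (T.toLinearMap ∘ₗ π g₀) := by
    have e := congrArg Representation.IntertwiningMap.toLinearMap hfix
    simp only [toLinearMap_conjIntertwiner] at e
    have e' := congrArg (fun f : V →ₗ[k] V => f ∘ₗ π g₀) e
    simp only [LinearMap.comp_assoc] at e'
    rw [← Module.End.mul_eq_comp (π g₀⁻¹), ← map_mul, inv_mul_cancel, map_one] at e'
    rw [one_smul, ← e']
    rfl
  obtain ⟨i, h, hh, rfl⟩ := hgen g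
  have hi := comp_pow_eq_smul_of_comp_eq_smul π T.toLinearMap h0 i
  rw [one_pow, one_smul] at hi
  have hN : π h ∘ₗ T.toLinearMap = T.toLinearMap ∘ₗ π h :=
    LinearMap.ext fun v => (intertwiningMap_apply_comm π N T hh v).symm
  rw [map_mul, Module.End.mul_eq_comp, LinearMap.comp_assoc, hN, ← LinearMap.comp_assoc, hi,
    LinearMap.comp_assoc]

end SemiInvariant

section Dichotomy

/-- **Clifford's dichotomy for a normal subgroup with finite cyclic quotient.**  Let `k` be an
algebraically closed field, `π` an irreducible representation of a group `G` on a
finite-dimensional `k`-space, `N ◁ G` a normal subgroup such that `G/N` is cyclic, generated by the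
class of `g₀`, of order dividing `m` with `m ≠ 0` in `k` (hypotheses `hg₀ : g₀ ^ m ∈ N` and
`hgen : every g is g₀ ^ i * h with h ∈ N`).  Then EITHER the restriction `π|_N` is irreducible, OR
`π ≅ π ⊗ χ` for a character `χ : G → kˣ` that is trivial on `N`, non-trivial, and of order dividing
`m`.  Proof: `π|_N` is semisimple (Clifford); if it is reducible, `End_N(π)` contains a non-scalar
element, so the conjugation action `A` of `g₀` on `End_N(π)` (with `A^m = 1`) is not the identity
(`End_G(π) = k`, Schur); an eigenvector `T` of `A` with eigenvalue `λ ≠ 1` is a non-zero operator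
with `π(g) T = χ(g) T π(g)` for a character `χ` (`χ(g₀) = λ`, `χ|_N = 1`), i.e. an isomorphism
`π ≅ π ⊗ χ⁻¹`.  Clifford 1937, Thms. 1–3; Curtis–Reiner (1962), (49.2), (51.7).
[cite: Clifford1937, Thm. 1] -/
theorem clifford_cyclic {k : Type*} [Field k] [IsAlgClosed k] {G : Type*} [Group G] {V : Type*}
    [AddCommGroup V] [Module k V] [FiniteDimensional k V] (π : Representation k G V)
    (hπ : π.IsIrreducible) (N : Subgroup G) [N.Normal] {g₀ : G} {m : ℕ} (hm : (m : k) ≠ 0)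
    (hg₀ : g₀ ^ m ∈ N) (hgen : ∀ g : G, ∃ (i : ℕ) (h : G), h ∈ N ∧ g = g₀ ^ i * h) :
    (Representation.restrictSubgroup π N).IsIrreducible ∨
      ∃ χ : G →* kˣ, (∀ h ∈ N, χ h = 1) ∧ χ ≠ 1 ∧ (∀ g, χ g ^ m = 1) ∧
        Nonempty (π.Equiv (Representation.twist π χ)) := by
  classical
  by_cases hirrN : (Representation.restrictSubgroup π N).IsIrreducible
  · exact Or.inl hirrN
  right
  haveI := hπ
  haveI : Nontrivial V := Representation.nontrivial_of_isIrreducible π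
  -- `π|_N` is semisimple (Clifford)
  have hss : (Representation.restrictSubgroup π N).IsSemisimpleRepresentation :=
    Representation.isSemisimpleRepresentation_restrictSubgroup π N (by
      change ComplementedLattice _
      infer_instance)
  -- a non-scalar `N`-intertwiner
  obtain ⟨T₀, hT₀⟩ := exists_nonscalar_intertwiningMap_of_not_isIrreducible _ hss hirrN
  -- the conjugation operator of `g₀` on `End_N(π)`
  set A := conjIntertwinerLinear π N g₀ with hA
  have hAm : A ^ m = 1 := by
    refine LinearMap.ext fun T => ?_
    rw [conjIntertwinerLinear_pow_apply, Module.End.one_apply]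
    exact conjIntertwiner_of_mem π N hg₀ T
  have hA1 : A ≠ 1 := by
    intro hA1
    have hfix : conjIntertwiner π N g₀ T₀ = T₀ := by
      have := congrArg (fun f => f T₀) hA1
      simpa only [hA, conjIntertwinerLinear_apply, Module.End.one_apply] using this
    -- `T₀` is a `G`-intertwiner, hence scalar (Schur)
    let S : π.IntertwiningMap π :=
      ⟨T₀.toLinearMap, fun g => (comp_eq_comp_of_conj_fixed π N T₀ hfix hgen g).symm⟩
    obtain ⟨c, hc⟩ :=
      (Representation.IsIrreducible.algebraMap_intertwiningMap_bijective_of_isAlgClosed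
        (ρ := π)).2 S
    apply hT₀ c
    have hc' := congrArg Representation.IntertwiningMap.toLinearMap hc
    rw [Representation.IntertwiningMap.algebraMap_apply,
      Representation.IntertwiningMap.toLinearMap_smul] at hc'
    rw [← hc']
    rfl
  -- an eigenvector of `A` with eigenvalue `λ ≠ 1`
  obtain ⟨lam, T, hT0, hAT, hlam1, hlamm⟩ := exists_eigenvector_ne_one_of_pow_eq_one A hm hAm hA1
  set Tl : V →ₗ[k] V := T.toLinearMap with hTl
  have hTl0 : Tl ≠ 0 := fun h0 =>
    hT0 (Representation.IntertwiningMap.ext (h0.trans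
      (Representation.IntertwiningMap.zero_toLinearMap (ρ := Representation.restrictSubgroup π N)
        (σ := Representation.restrictSubgroup π N)).symm))
  -- `π g₀ ∘ T = λ • T ∘ π g₀`
  have hg₀T : π g₀ ∘ₗ Tl = lam • (Tl ∘ₗ π g₀) := by
    have e := congrArg Representation.IntertwiningMap.toLinearMap hAT
    simp only [hA, conjIntertwinerLinear_apply, toLinearMap_conjIntertwiner,
      Representation.IntertwiningMap.toLinearMap_smul] at e
    have e' := congrArg (fun f : V →ₗ[k] V => f ∘ₗ π g₀) e
    simp only [LinearMap.comp_assoc, LinearMap.smul_comp] at e'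
    rw [← Module.End.mul_eq_comp (π g₀⁻¹), ← map_mul, inv_mul_cancel, map_one] at e'
    exact e'
  -- semi-invariance under all of `G`
  have hsemi : ∀ g : G, ∃ c : k, π g ∘ₗ Tl = c • (Tl ∘ₗ π g) := by
    intro g
    obtain ⟨i, h, hh, rfl⟩ := hgen g
    refine ⟨lam ^ i, ?_⟩
    have hN' : π h ∘ₗ Tl = Tl ∘ₗ π h :=
      LinearMap.ext fun v => (intertwiningMap_apply_comm π N T hh v).symm
    rw [map_mul, Module.End.mul_eq_comp, LinearMap.comp_assoc, hN', ← LinearMap.comp_assoc,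
      comp_pow_eq_smul_of_comp_eq_smul π Tl hg₀T i, LinearMap.smul_comp, LinearMap.comp_assoc]
  obtain ⟨χ, hχ⟩ := exists_character_of_semiInvariant π Tl hTl0 hsemi
  -- `χ` is trivial on `N`
  have hχN : ∀ h ∈ N, χ h = 1 := by
    intro h hh
    have hN' : π h ∘ₗ Tl = (1 : k) • (Tl ∘ₗ π h) := by
      rw [one_smul]
      exact LinearMap.ext fun v => (intertwiningMap_apply_comm π N T hh v).symm
    have := (hχ h).2 1 hN'
    exact Units.val_eq_one.1 this.symm
  -- `χ g₀ = λ ≠ 1`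
  have hχg₀ : (χ g₀ : k) = lam := ((hχ g₀).2 lam hg₀T).symm
  have hχ1 : χ ≠ 1 := by
    intro h1
    apply hlam1
    rw [← hχg₀, h1, MonoidHom.one_apply, Units.val_one]
  -- `χ g ^ m = 1`
  have hχm : ∀ g, χ g ^ m = 1 := by
    intro g
    obtain ⟨i, h, hh, rfl⟩ := hgen g
    rw [map_mul, hχN h hh, mul_one, map_pow, ← pow_mul, mul_comm, pow_mul]
    refine Units.val_eq_one.1 ?_
    rw [Units.val_pow_eq_pow_val, Units.val_pow_eq_pow_val, hχg₀, hlamm, one_pow]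
  -- `T : π ≅ π ⊗ χ⁻¹`
  let I : π.IntertwiningMap (Representation.twist π χ⁻¹) :=
    ⟨Tl, fun g => by
      rw [Representation.twist_apply, LinearMap.smul_comp, (hχ g).1, smul_smul,
        MonoidHom.inv_apply, Units.inv_mul, one_smul]⟩
  have hI : Function.Bijective I := by
    rcases Representation.IsIrreducible.bijective_or_eq_zero I with hb | h0
    · exact hb
    · exact absurd (congrArg Representation.IntertwiningMap.toLinearMap h0) hTl0
  refine ⟨χ⁻¹, fun h hh => by rw [MonoidHom.inv_apply, hχN h hh, inv_one], fun h1 => hχ1 ?_,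
    fun g => by rw [MonoidHom.inv_apply, inv_pow, hχm, inv_one], ⟨I.ofBijective hI⟩⟩
  exact MonoidHom.ext fun g => by
    have := DFunLike.congr_fun h1 g
    simpa only [MonoidHom.inv_apply, MonoidHom.one_apply, inv_eq_one] using this

end Dichotomy

end Summit.Langlands.Langlands.Theorems.IrreducibleOffSector

end
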